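import Literature.Probability.Percolation.SlabRSWSnapFrame
import Literature.Probability.Percolation.SlabRSWSnapRoute
import Literature.Probability.Percolation.SlabRSWGluingRouteB
import Literature.Probability.Percolation.SlabRSWGluingSegment
import HarnessLib

/-!
# Newman–Tassion–Wu 2017, Lemma 3.16 — the two surgeries for the coarse-grained datum, assembled
# from a free routing region and the neighbouring tiles

Topic: `Literature/Probability/Percolation`. For the datum `Q₂ = snapGlue n hn Γ`
(`SlabRSWSnapDatum.lean`: `S = R' ∖ N(Γ)`, `R = R'`, `A = C`, `B = τN ∖ N`, `C = τC`) and a lattice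
configuration of `𝒳`, this file turns

* a box `B₀ ⊆ R'` free of `A`- and `C`-cells, a free routing region `K ⊆ B₀` (no cell of
  `M = N ∪ τN`) with a router, two vertices of `Γ₁ = Γ_min` over `K`, a normalised contact whose end
  lies over `D`, and a PORT-CHAIN supply (every tile cell of `D` off `K` is reached from an entry cell
  of `K` through tile cells of `D`)

into a surgery (`GlueData.Surgery`, cleared set `D = K ∪ (N ∩ B₀)`: `exists_surgery_snap`) or — when
in addition two (entry cell, target cell) pairs towards `B = τN ∖ N` are given — a surgery ending in
`B̄` (`GlueData.SurgeryB`, cleared set `D = K ∪ (M ∩ B₀)`: `exists_surgeryB_snap`). The geometric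
case analysis (which `K`, which chains) is done per layout in the next file.

## Sources

* C. M. Newman, V. Tassion, W. Wu, *Critical percolation and the minimal spanning tree in slabs*,
  Comm. Pure Appl. Math. 70 (2017), arXiv:1512.09107: §3.2, proof of Theorem 3.7, steps (1)–(3);
  §3.5, proof of Lemma 3.16 ("`K_□` … regular enough to apply Theorem 3.6") [NewmanTassionWu2017].
-/

noncomputable section

namespace Literature.Probability.Percolation

open MeasureTheory LatticeModels SimpleGraph

namespace NTW17

variable {k : ℕ}

section Assemble

variable {n : ℕ} (hn : 1 ≤ n) {Γ : List (slab 3 k)} {ω : BondConfig (slab 3 k)}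

/-- The box `R'` of the datum. [cite: NewmanTassionWu2017, §3.5 (Lemma 3.16, R)] -/
theorem snapGlue_mem_R_iff {z : ℤ × ℤ} :
    z ∈ (snapGlue k n hn Γ).R ↔ 0 ≤ z.1 ∧ z.1 ≤ 14 * n ∧ 0 ≤ z.2 ∧ z.2 ≤ 13 * n - 1 := by
  rw [snapGlue_R, mem_boxR_iff]

/-- **The plain surgery of the coarse-grained datum.** See the module docstring: cleared set
`D = K ∪ (N(Γ) ∩ B₀)`, trunk rerouted inside the free region `K` (router `hroute`), branch to the
port of the `C`-path inside `D`, through the tiles of `N(Γ)` when the port is there (`hchain`).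
[cite: NewmanTassionWu2017, §3.2 (proof of Theorem 3.7, steps (1)–(3)); §3.5 (proof of Lemma 3.16)] -/
theorem exists_surgery_snap (hω : ω ⊆ (slabGraph 3 k).edgeSet) (hX : ω ∈ (snapGlue k n hn Γ).evX k)
    {x₁ x₂ y₁ y₂ : ℤ} (hB : boxR x₁ x₂ y₁ y₂ ⊆ boxR 0 (14 * n) 0 (13 * n - 1))
    (hBA : ∀ z ∈ boxR x₁ x₂ y₁ y₂, z ∉ (snapGlue k n hn Γ).A)
    (hBC : ∀ z ∈ boxR x₁ x₂ y₁ y₂, z ∉ (snapGlue k n hn Γ).C)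
    {K : Set (ℤ × ℤ)} (hKB : K ⊆ boxR x₁ x₂ y₁ y₂)
    (hKM : ∀ z ∈ K, z ∉ snapNbhd k n Γ ∧ z ∉ snapNbhdR k n Γ)
    (hroute : ∀ (E₁ E₂ w : slab 3 k), planar k E₁ ∈ K → planar k E₂ ∈ K → planar k w ∈ K → E₁ ≠ E₂ →
      planar k E₁ ≠ planar k w → planar k E₂ ≠ planar k w → ∃ L Br c, RouteSpec k K K E₁ E₂ w L Br c)
    (htwo : ∃ x ∈ (snapGlue k n hn Γ).γ k ω, ∃ y ∈ (snapGlue k n hn Γ).γ k ω,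
      x ≠ y ∧ planar k x ∈ K ∧ planar k y ∈ K)
    {c₀ q : slab 3 k} {l : List (slab 3 k)} (hc₀ : c₀ ∈ slabLift k (snapGlue k n hn Γ).C)
    (hch : (l ++ [q]).IsChain (fun a b => s(a, b) ∈ ω ∧ a ≠ b)) (hnd : (l ++ [q]).Nodup)
    (hsub : ∀ x ∈ l ++ [q], x ∈ slabLift k (snapGlue k n hn Γ).R) (hhead : (l ++ [q]).head (by simp) = c₀)
    (hfar : ∀ x ∈ l, ¬Near k ((snapGlue k n hn Γ).γ k ω) 1 (planar k x)) (hl : l ≠ [])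
    (hqD : planar k q ∈ K ∪ (snapNbhd k n Γ ∩ boxR x₁ x₂ y₁ y₂))
    (hchain : ∀ t : ℤ × ℤ, t ∈ snapNbhd k n Γ → t ∈ boxR x₁ x₂ y₁ y₂ → t ∉ K → ∀ f₁ f₂ : ℤ × ℤ,
      ∃ e m : ℤ × ℤ, e ∈ K ∧ e ≠ f₁ ∧ e ≠ f₂ ∧ planarAdj e m ∧ ∃ l' : List (ℤ × ℤ), PPath l' m t ∧
        ∀ z ∈ l', (z ∈ snapNbhd k n Γ ∧ z ∈ boxR x₁ x₂ y₁ y₂) ∧ z ∉ K) :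
    ∃ sx : (snapGlue k n hn Γ).Surgery k ω, sx.D = K ∪ (snapNbhd k n Γ ∩ boxR x₁ x₂ y₁ y₂) := by
  set Q := snapGlue k n hn Γ with hQ
  set B := boxR x₁ x₂ y₁ y₂ with hBdef
  set D : Set (ℤ × ℤ) := K ∪ (snapNbhd k n Γ ∩ B) with hD
  have hA : ω ∈ Q.evAB k := hX.1
  obtain ⟨hγO, -⟩ := Q.γ_spec hA
  have hDB : D ⊆ B := by
    rintro z (hz | ⟨-, hz⟩)
    · exact hKB hz
    · exact hz
  have hDR : D ⊆ Q.R := fun z hz => by rw [hQ, snapGlue_R]; exact hB (hDB hz)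
  have hDA : ∀ z ∈ D, z ∉ Q.A := fun z hz => hBA z (hDB hz)
  have hDQB : ∀ z ∈ D, z ∉ Q.B := by
    rintro z (hz | ⟨hz, -⟩) hzB
    · rw [hQ, snapGlue_B] at hzB; exact (hKM z hz).2 hzB.1
    · rw [hQ, snapGlue_B] at hzB; exact hzB.2 hz
  have hKD : K ⊆ D := Set.subset_union_left
  have hKS : K ⊆ Q.S := fun z hz => by
    rw [hQ, snapGlue_S]; exact ⟨hB (hKB hz), (hKM z hz).1⟩
  have hc₀D : planar k c₀ ∉ D := fun h => hBC _ (hDB h) hc₀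
  -- the port
  obtain ⟨w', q₁, hadj, hw'D, hq₁D, hσ, hw'far⟩ :=
    exists_port (Q := Q) hω hch hnd hsub hhead hfar hl le_rfl hqD hc₀D
  have hw'γ : ∀ v ∈ Q.γ k ω, planar k v ≠ planar k w' := fun v hv h =>
    hw'far ⟨v, hv, by rw [← h]; exact mem_sqBox_self _ _⟩
  -- two vertices of `γ` over `D`
  have htwo' : ∃ x ∈ Q.γ k ω, ∃ y ∈ Q.γ k ω, x ≠ y ∧ planar k x ∈ D ∧ planar k y ∈ D := by
    obtain ⟨x, hx, y, hy, hxy, hxK, hyK⟩ := htwo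
    exact ⟨x, hx, y, hy, hxy, hKD hxK, hKD hyK⟩
  -- routes: vertices of `γ` over `D` are over `K`
  have hγK : ∀ v ∈ Q.γ k ω, planar k v ∈ D → planar k v ∈ K := by
    rintro v hv (h | ⟨hN, -⟩)
    · exact h
    · have := hγO.subset v hv
      rw [mem_slabLift_iff, hQ, snapGlue_S] at this
      exact absurd hN this.2
  have hroutes : ∀ E₁ E₂ : slab 3 k, E₁ ∈ Q.γ k ω → E₂ ∈ Q.γ k ω → E₁ ≠ E₂ →
      planar k E₁ ∈ D → planar k E₂ ∈ D → ∃ L Br c, RouteSpec k K D E₁ E₂ w' L Br c := by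
    intro E₁ E₂ hE₁ hE₂ hne hE₁D hE₂D
    refine exists_route_port hKD hroute (hγK E₁ hE₁ hE₁D) (hγK E₂ hE₂ hE₂D) hne (hw'γ E₁ hE₁)
      (hw'γ E₂ hE₂) fun hnK f₁ f₂ => ?_
    have hw'N : planar k w' ∈ snapNbhd k n Γ ∧ planar k w' ∈ B := by
      rcases hw'D with h | h
      · exact absurd h hnK
      · exact h
    obtain ⟨e, m, he, he₁, he₂, hem, l', hl', hmem⟩ := hchain _ hw'N.1 hw'N.2 hnK f₁ f₂
    exact ⟨e, m, he, he₁, he₂, hem, l', hl', fun z hz => ⟨Or.inr (hmem z hz).1, (hmem z hz).2⟩⟩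
  obtain ⟨sx, hsx⟩ := exists_surgery_of_route (Q := Q) hX hDR hDA hDQB hKD hKS htwo' hadj hq₁D hc₀ hσ
    hroutes
  exact ⟨sx, hsx⟩

/-- **The surgery ending in `B̄ = (τN ∖ N)‾` of the coarse-grained datum.** As
`exists_surgery_snap`, with cleared set `D = K ∪ (M ∩ B₀)` (`M = N ∪ τN`), one vertex of `Γ₁` over
`K` that is not its last, two pairs `(bᵢ, tᵢ)` of a cell of `K` and an adjacent cell of `τN ∖ N`
inside the box with `b₁ ≠ b₂`, and the port chains through all tiles of `M`.
[cite: NewmanTassionWu2017, §3.2 (proof of Theorem 3.7, steps (1)–(3), "if z = v we take v = v′ = z"); §3.5 (proof of Lemma 3.16)] -/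
theorem exists_surgeryB_snap (hk : 1 ≤ k) (hω : ω ⊆ (slabGraph 3 k).edgeSet)
    (hX : ω ∈ (snapGlue k n hn Γ).evX k)
    {x₁ x₂ y₁ y₂ : ℤ} (hB : boxR x₁ x₂ y₁ y₂ ⊆ boxR 0 (14 * n) 0 (13 * n - 1))
    (hBA : ∀ z ∈ boxR x₁ x₂ y₁ y₂, z ∉ (snapGlue k n hn Γ).A)
    (hBC : ∀ z ∈ boxR x₁ x₂ y₁ y₂, z ∉ (snapGlue k n hn Γ).C)
    {K : Set (ℤ × ℤ)} (hKB : K ⊆ boxR x₁ x₂ y₁ y₂)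
    (hKM : ∀ z ∈ K, z ∉ snapNbhd k n Γ ∧ z ∉ snapNbhdR k n Γ)
    (hroute : ∀ (E₁ E₂ w : slab 3 k), planar k E₁ ∈ K → planar k E₂ ∈ K → planar k w ∈ K → E₁ ≠ E₂ →
      planar k E₁ ≠ planar k w → planar k E₂ ≠ planar k w → ∃ L Br c, RouteSpec k K K E₁ E₂ w L Br c)
    (hin : ∃ x ∈ (snapGlue k n hn Γ).γ k ω, planar k x ∈ K ∧
      ∀ hne : (snapGlue k n hn Γ).γ k ω ≠ [], x ≠ ((snapGlue k n hn Γ).γ k ω).getLast hne)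
    {b₁ t₁ b₂ t₂ : ℤ × ℤ} (hb₁ : b₁ ∈ K) (hb₂ : b₂ ∈ K) (hb : b₁ ≠ b₂)
    (ht₁ : t₁ ∈ snapNbhdR k n Γ ∧ t₁ ∉ snapNbhd k n Γ ∧ t₁ ∈ boxR x₁ x₂ y₁ y₂)
    (ht₂ : t₂ ∈ snapNbhdR k n Γ ∧ t₂ ∉ snapNbhd k n Γ ∧ t₂ ∈ boxR x₁ x₂ y₁ y₂)
    (hadj₁ : planarAdj b₁ t₁) (hadj₂ : planarAdj b₂ t₂)
    {c₀ q : slab 3 k} {l : List (slab 3 k)} (hc₀ : c₀ ∈ slabLift k (snapGlue k n hn Γ).C)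
    (hch : (l ++ [q]).IsChain (fun a b => s(a, b) ∈ ω ∧ a ≠ b)) (hnd : (l ++ [q]).Nodup)
    (hsub : ∀ x ∈ l ++ [q], x ∈ slabLift k (snapGlue k n hn Γ).R) (hhead : (l ++ [q]).head (by simp) = c₀)
    (hfar : ∀ x ∈ l, ¬Near k ((snapGlue k n hn Γ).γ k ω) 1 (planar k x)) (hl : l ≠ [])
    (hqD : planar k q ∈ K ∪ ((snapNbhd k n Γ ∪ snapNbhdR k n Γ) ∩ boxR x₁ x₂ y₁ y₂))
    (hchain : ∀ t : ℤ × ℤ, t ∈ snapNbhd k n Γ ∪ snapNbhdR k n Γ → t ∈ boxR x₁ x₂ y₁ y₂ → t ∉ K →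
      ∀ f₁ f₂ : ℤ × ℤ, ∃ e m : ℤ × ℤ, e ∈ K ∧ e ≠ f₁ ∧ e ≠ f₂ ∧ planarAdj e m ∧
        ∃ l' : List (ℤ × ℤ), PPath l' m t ∧
          ∀ z ∈ l', (z ∈ snapNbhd k n Γ ∪ snapNbhdR k n Γ ∧ z ∈ boxR x₁ x₂ y₁ y₂) ∧ z ∉ K) :
    ∃ sb : (snapGlue k n hn Γ).SurgeryB k ω,
      sb.D = K ∪ ((snapNbhd k n Γ ∪ snapNbhdR k n Γ) ∩ boxR x₁ x₂ y₁ y₂) := by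
  set Q := snapGlue k n hn Γ with hQ
  set B := boxR x₁ x₂ y₁ y₂ with hBdef
  set M := snapNbhd k n Γ ∪ snapNbhdR k n Γ with hM
  set D : Set (ℤ × ℤ) := K ∪ (M ∩ B) with hD
  have hA : ω ∈ Q.evAB k := hX.1
  obtain ⟨hγO, -⟩ := Q.γ_spec hA
  have hDB : D ⊆ B := by
    rintro z (hz | ⟨-, hz⟩)
    · exact hKB hz
    · exact hz
  have hDR : D ⊆ Q.R := fun z hz => by rw [hQ, snapGlue_R]; exact hB (hDB hz)
  have hDA : ∀ z ∈ D, z ∉ Q.A := fun z hz => hBA z (hDB hz)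
  have hKD : K ⊆ D := Set.subset_union_left
  have hc₀D : planar k c₀ ∉ D := fun h => hBC _ (hDB h) hc₀
  -- the port
  obtain ⟨w', q₁, hadj, hw'D, hq₁D, hσ, hw'far⟩ :=
    exists_port (Q := Q) hω hch hnd hsub hhead hfar hl le_rfl hqD hc₀D
  have hw'γ : ∀ v ∈ Q.γ k ω, planar k v ≠ planar k w' := fun v hv h =>
    hw'far ⟨v, hv, by rw [← h]; exact mem_sqBox_self _ _⟩
  -- the decomposition at the first vertex over `D`
  obtain ⟨x, hxγ, hxK, hxl⟩ := hin
  obtain ⟨p₀, E₁, rest, hγeq, hp₀, hrest, hp₀D, hE₁D⟩ :=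
    exists_decompB (Q := Q) hA hDA ⟨x, hxγ, hKD hxK, hxl hγO.ne_nil⟩
  have hE₁γ : E₁ ∈ Q.γ k ω := by rw [hγeq]; simp
  have hE₁B : planar k E₁ ∉ Q.B := by
    intro hB'
    have hex : ∃ l, IsOSAP k ω (slabLift k Q.S) (slabLift k Q.A) (slabLift k Q.B) l :=
      (mem_slabConn_iff_exists_isOSAP ω _ _ _).1 hA
    have h := minPath_prefix_getLast_not_mem Q.S_finite hex (p := p₀ ++ [E₁]) (s := rest)
      (by rw [show minPath k ω _ _ _ = Q.γ k ω from rfl, hγeq]; simp) hrest (by simp)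
    simp only [List.getLast_append_of_ne_nil _ (List.cons_ne_nil _ _), List.getLast_singleton,
      mem_slabLift_iff] at h
    exact h hB'
  have hE₁S : planar k E₁ ∈ Q.S := hγO.subset E₁ hE₁γ
  have hE₁K : planar k E₁ ∈ K := by
    rcases hE₁D with h | ⟨hM', -⟩
    · exact h
    · exfalso
      rw [hQ, snapGlue_S] at hE₁S
      rcases hM' with hN | hR
      · exact hE₁S.2 hN
      · exact hE₁B (by rw [hQ, snapGlue_B]; exact ⟨hR, hE₁S.2⟩)
  -- the route ending in `B̄`
  have ht₁D : t₁ ∈ D := Or.inr ⟨Or.inr ht₁.1, ht₁.2.2⟩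
  have ht₂D : t₂ ∈ D := Or.inr ⟨Or.inr ht₂.1, ht₂.2.2⟩
  have ht₁K : t₁ ∉ K := fun h => (hKM _ h).2 ht₁.1
  have ht₂K : t₂ ∉ K := fun h => (hKM _ h).2 ht₂.1
  have hport : planar k w' ∉ K → ∀ f₁ f₂ : ℤ × ℤ, ∃ e m : ℤ × ℤ, e ∈ K ∧ e ≠ f₁ ∧ e ≠ f₂ ∧ planarAdj e m ∧
      ∃ l' : List (ℤ × ℤ), PPath l' m (planar k w') ∧ ∀ z ∈ l', z ∈ D ∧ z ∉ K := by
    intro hnK f₁ f₂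
    have hw'M : planar k w' ∈ M ∧ planar k w' ∈ B := by
      rcases hw'D with h | h
      · exact absurd h hnK
      · exact h
    obtain ⟨e, m, he, he₁, he₂, hem, l', hl', hmem⟩ := hchain _ hw'M.1 hw'M.2 hnK f₁ f₂
    exact ⟨e, m, he, he₁, he₂, hem, l', hl', fun z hz => ⟨Or.inr (hmem z hz).1, (hmem z hz).2⟩⟩
  obtain ⟨t, hβ, ht, hβk, L, Br, c, spec, hint⟩ := exists_routeB_port hk hKD hroute hE₁K (hw'γ E₁ hE₁γ)
    hb₁ hb₂ hb ht₁D ht₁K ht₂D ht₂K hadj₁ hadj₂ hport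
  have htfacts : t ∈ snapNbhdR k n Γ ∧ t ∉ snapNbhd k n Γ ∧ t ∈ B := by
    rcases ht with rfl | rfl
    · exact ht₁
    · exact ht₂
  have htK : t ∉ K := fun h => (hKM _ h).2 htfacts.1
  have hE₁β : E₁ ≠ vtx k t hβ := by
    intro h
    apply htK
    have := congrArg (planar k) h
    rw [planar_vtx] at this
    rw [← this]; exact hE₁K
  have hβD : planar k (vtx k t hβ) ∈ D := by rw [planar_vtx]; exact Or.inr ⟨Or.inr htfacts.1, htfacts.2.2⟩
  have hβS : planar k (vtx k t hβ) ∈ Q.S := by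
    rw [planar_vtx, hQ, snapGlue_S]; exact ⟨hB htfacts.2.2, htfacts.2.1⟩
  have hβB : planar k (vtx k t hβ) ∈ Q.B := by
    rw [planar_vtx, hQ, snapGlue_B]; exact ⟨htfacts.1, htfacts.2.1⟩
  have hint' : ∀ v ∈ L, v ≠ E₁ → v ≠ vtx k t hβ → planar k v ∈ Q.S ∧ planar k v ∉ Q.B := by
    intro v hv h1 h2
    have hvK := hint v hv h1 h2
    refine ⟨by rw [hQ, snapGlue_S]; exact ⟨hB (hKB hvK), (hKM _ hvK).1⟩, fun hvB => ?_⟩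
    rw [hQ, snapGlue_B] at hvB
    exact (hKM _ hvK).2 hvB.1
  obtain ⟨sb, hsb⟩ := exists_surgeryB_of_decomp (Q := Q) hDR hDA hγeq hp₀ hrest hp₀D hE₁D hE₁β hβD hβS
    hβB hadj hq₁D hc₀ hσ spec hint'
  exact ⟨sb, hsb⟩

end Assemble

end NTW17

end Literature.Probability.Percolation
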